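import Summits.ValiantsHypothesis.ValiantsHypothesis.Theorems.SymPencilSingSixClassificationDefs
import Mathlib.Algebra.Module.Submodule.Union
import Mathlib.Algebra.CharZero.Infinite

/-!
# Crux workfile `SdcSuperquadratic` — line `sing_six_classification`, COMPANION FILE «leaf 5b»
# (val-idea-18 g4, lens cascade; rev 3.0): the algebraic two-row classification `twoRowClassify`,
# PROVED WITHOUT `sorry`, over the TREE's ported definitions

This file is the proof of the LAST leaf (5b) of the skeleton `Lines/sing_six_classification.lean`,
split off because the sorry-free monolithic skeleton (rev 3.0, 248 133 bytes, farm rc 0,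
`#print axioms sixDim_perDir_list` = `propext, Classical.choice, Quot.sound`; attached in full as
evidence on stmt-ValiantsHypothesis-5674) exceeds the 200 000-byte cap of a crux workfile.  It is
stated over the PORTED definitions of val-width-5674-w2's
`Theorems/SymPencilSingSixClassificationDefs.lean` (p628115: `T3`, `pairPerm`, `row`, `rowL`,
`WColType`, `W2Type` — byte-identical to the skeleton's), so that the port owner (R223 (a)) can land
it as one more part; the few transport helpers of later port parts that it needs (`rowPermL`,
`mem_iff_map_equiv`, `fin4_of_perm`, `exists_perm_zero_one`, `compPermL`/`T3_perm`, `T3_explicit`,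
`pairPerm_comm`, `biPermL`) are re-declared here verbatim inside this file's own namespace (drop
them when the corresponding parts are importable).

THE STATEMENT (5b, memo `SING-SIX-CLASSIFICATION.md` §5.3; verbatim the skeleton's
`stub_twoRowClassify` of rev 2.8): over a field of characteristic `0`, a `6`-dimensional
`W ≤ K^{4×4}` supported on rows `0,1` such that for every `y ∈ W` the symmetric pencil matrix
`P(y₀,y₁) = (T3 e_k y₀ y₁ l)_{k,l}` is singular (`TPDegenerate`) is `W_col` (both rows in one
coordinate hyperplane) or `W₂` (row `0` free, row `1` in a coordinate plane).

THE PROOF.  `Δ6 a b c d e f` = the Cayley form `(af)²+(be)²+(cd)²−2(af·be+af·cd+be·cd)` in the six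
pair permanents `π_{pq}(α,β)` is `det P(α,β)`; `TPDegenerate α β ⇒ ΔP α β = 0` by four
`linear_combination`s with the written-out adjugate (`ΔP_eq_zero_of_tpDegenerate`);
`ΔP (t•α) β = t⁴ ΔP α β` and a fifth finite difference give the `t → 0` limit (`ΔP_limit`,
characteristic `0`); test families `(t,0,1,1), (0,t,1,1), (0,1,t,1), (0,1,1,t)` give
`triples_zero_of_ΔP`; the driver `twoRowClassify_of` splits on the two row projections (onto ⇒
graph case `caseTopNorm` after a column transport, using the rank count `fibre_aux` and the
finite-union lemma; neither onto ⇒ both projections are `3`-dimensional and `W ⊇ A ⊕ B` ⇒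
hyperplane case `caseHyp`: coordinate sub-case `hyp_coord`, non-coordinate sub-case impossible by
`noncoord_pivot3` — a normal functional, a vector of `B` with no zero coordinate, a pivot transport
and five explicit test points).  All polynomial identities were pre-verified exactly
(`compute/check5b*.py`, pure python, seconds).

What it is NOT: no summit statement and no crux (`SdcSuperquadratic`, `27 ≤ sdc per₄`) is proved
here or in the skeleton — this is the non-coordinate half of ONE size-`27` cell `(10,6,6)` of the
5674 programme (a rung tool).  [folklore]
-/

noncomputable section
set_option linter.dupNamespace false
set_option linter.unusedVariables false
set_option linter.unusedSectionVars false

open MvPolynomial Module Literature.Computability.AlgebraicComplexity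
open Summit.ValiantsHypothesis.ValiantsHypothesis.Theorems.SymPencilSingSixClassification

namespace Summit.ValiantsHypothesis.ValiantsHypothesis.Cruxes.SdcSuperquadratic.SingSixLeaf5b

variable {K : Type*} [Field K]

/-! ### Helpers re-declared from the skeleton (verbatim; later port parts contain them) -/

/-- Row permutation `x ↦ ((i, j) ↦ x (σ i, j))` as a linear equivalence. -/
def rowPermL (σ : Equiv.Perm (Fin 4)) : (Fin 4 × Fin 4 → K) ≃ₗ[K] (Fin 4 × Fin 4 → K) :=
  LinearEquiv.funCongrLeft K K (Equiv.prodCongr σ (Equiv.refl (Fin 4)))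

@[simp] theorem rowPermL_apply (σ : Equiv.Perm (Fin 4)) (x : Fin 4 × Fin 4 → K) (i j : Fin 4) :
    rowPermL σ x (i, j) = x (σ i, j) := rfl

theorem mem_iff_map_equiv (e : (Fin 4 × Fin 4 → K) ≃ₗ[K] (Fin 4 × Fin 4 → K))
    (W : Submodule K (Fin 4 × Fin 4 → K)) (x : Fin 4 × Fin 4 → K) :
    x ∈ W ↔ e x ∈ W.map (e : (Fin 4 × Fin 4 → K) →ₗ[K] (Fin 4 × Fin 4 → K)) := by
  rw [Submodule.mem_map_equiv, LinearEquiv.symm_apply_apply]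

omit [Field K] in
theorem fin4_of_perm (ρ : Equiv.Perm (Fin 4)) (i : Fin 4) :
    i = ρ 0 ∨ i = ρ 1 ∨ i = ρ 2 ∨ i = ρ 3 := by
  obtain ⟨m, rfl⟩ := ρ.surjective i
  fin_cases m <;> simp

/-- A permutation of `Fin 4` taking `0 ↦ j`, `1 ↦ c`. -/
theorem exists_perm_zero_one {j c : Fin 4} (hjc : j ≠ c) :
    ∃ γ : Equiv.Perm (Fin 4), γ 0 = j ∧ γ 1 = c := by
  refine ⟨(Equiv.swap (0 : Fin 4) j).trans (Equiv.swap (Equiv.swap (0 : Fin 4) j 1) c), ?_, ?_⟩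
  · have h1 : j ≠ Equiv.swap (0 : Fin 4) j 1 := by
      intro h
      have h' : Equiv.swap (0 : Fin 4) j 0 = Equiv.swap (0 : Fin 4) j 1 := by
        rw [Equiv.swap_apply_left]; exact h
      exact absurd ((Equiv.swap (0 : Fin 4) j).injective h') (by decide)
    rw [Equiv.trans_apply, Equiv.swap_apply_left, Equiv.swap_apply_of_ne_of_ne h1 hjc]
  · rw [Equiv.trans_apply, Equiv.swap_apply_left]

/-- `w ↦ w ∘ γ` as a linear map. -/
def compPermL (γ : Equiv.Perm (Fin 4)) : (Fin 4 → K) →ₗ[K] (Fin 4 → K) where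
  toFun w := w ∘ γ
  map_add' _ _ := rfl
  map_smul' _ _ := rfl

@[simp] theorem compPermL_apply (γ : Equiv.Perm (Fin 4)) (w : Fin 4 → K) :
    compPermL (K := K) γ w = w ∘ γ := rfl

/-- `T3` is equivariant under a simultaneous permutation of the four coordinates
(column-permutation invariance of the permanent). -/
theorem T3_perm (γ : Equiv.Perm (Fin 4)) (u v w : Fin 4 → K) (l : Fin 4) :
    T3 (u ∘ γ) (v ∘ γ) (w ∘ γ) l = T3 u v w (γ l) := by
  let x : Fin 4 × Fin 4 → K := fun p => ![u, v, w, 0] p.1 p.2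
  let x' : Fin 4 × Fin 4 → K := fun p => x (p.1, γ p.2)
  have h1 : ((Matrix.of fun i j => x (i, j)).submatrix ![0, 1, 2] (γ l).succAbove).permanent =
      T3 u v w (γ l) := permanent_submatrix_eq_T3 x 0 1 2 (γ l)
  have h2 : ((Matrix.of fun i j => x' (i, j)).submatrix ![0, 1, 2] l.succAbove).permanent =
      T3 (u ∘ γ) (v ∘ γ) (w ∘ γ) l := permanent_submatrix_eq_T3 x' 0 1 2 l
  rw [← h1, ← h2]
  have hne : ∀ k, γ (l.succAbove k) ≠ γ l := fun k h => Fin.succAbove_ne l k (γ.injective h)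
  choose π hπ using fun k => Fin.exists_succAbove_eq (hne k)
  have hπi : Function.Injective π := by
    intro a b hab
    have h := hπ a
    rw [hab, hπ b] at h
    exact (Fin.succAbove_right_injective (γ.injective h)).symm
  have hπb : Function.Bijective π := Finite.injective_iff_bijective.mp hπi
  have hM : (Matrix.of fun i j => x' (i, j)).submatrix ![0, 1, 2] l.succAbove =
      ((Matrix.of fun i j => x (i, j)).submatrix ![0, 1, 2] (γ l).succAbove).submatrix id
        (Equiv.ofBijective π hπb) := by
    ext i k
    fin_cases i <;> simp [Matrix.submatrix_apply, x', hπ]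
  rw [hM, Matrix.permanent_permute_rows]

/-- The four components of `T3` written out. -/
theorem T3_explicit (u v w : Fin 4 → K) :
    T3 u v w 0 = u 1 * (v 2 * w 3 + v 3 * w 2) + u 2 * (v 1 * w 3 + v 3 * w 1) +
      u 3 * (v 1 * w 2 + v 2 * w 1) ∧
    T3 u v w 1 = u 0 * (v 2 * w 3 + v 3 * w 2) + u 2 * (v 0 * w 3 + v 3 * w 0) +
      u 3 * (v 0 * w 2 + v 2 * w 0) ∧
    T3 u v w 2 = u 0 * (v 1 * w 3 + v 3 * w 1) + u 1 * (v 0 * w 3 + v 3 * w 0) +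
      u 3 * (v 0 * w 1 + v 1 * w 0) ∧
    T3 u v w 3 = u 0 * (v 1 * w 2 + v 2 * w 1) + u 1 * (v 0 * w 2 + v 2 * w 0) +
      u 2 * (v 0 * w 1 + v 1 * w 0) := by
  refine ⟨?_, ?_, ?_, ?_⟩ <;> simp [T3, Fin.succAbove]

theorem pairPerm_comm (v w : Fin 4 → K) (p q : Fin 4) : pairPerm v w p q = pairPerm w v p q := by
  unfold pairPerm; ring

/-- Simultaneous row/column permutation `x ↦ ((i, j) ↦ x (ρ i, γ j))` as a linear equivalence. -/
def biPermL (ρ γ : Equiv.Perm (Fin 4)) : (Fin 4 × Fin 4 → K) ≃ₗ[K] (Fin 4 × Fin 4 → K) :=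
  LinearEquiv.funCongrLeft K K (Equiv.prodCongr ρ γ)

@[simp] theorem biPermL_apply (ρ γ : Equiv.Perm (Fin 4)) (x : Fin 4 × Fin 4 → K) (i j : Fin 4) :
    biPermL ρ γ x (i, j) = x (ρ i, γ j) := rfl

/-- Normal position for leaf 5: rows `2` and `3` vanish on `W` (the live rows are `0, 1`). -/
def RowsTwoThreeZero (W : Submodule K (Fin 4 × Fin 4 → K)) : Prop :=
  ∀ x ∈ W, ∀ j : Fin 4, x (2, j) = 0 ∧ x (3, j) = 0

/-- `P(α,β) := (T3 e_k α β l)_{k,l}` (the symmetric `4 × 4` matrix of `v ↦ T3 v α β`) is SINGULAR: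
a non-zero `v` with `T3 v α β ≡ 0` (equivalently `det P(α,β) = -4·f(α,β) = 0`, memo §5.1). -/
def TPDegenerate (α β : Fin 4 → K) : Prop :=
  ∃ v : Fin 4 → K, v ≠ 0 ∧ ∀ l : Fin 4, T3 v α β l = 0

/-- The two-row types pull back along a row permutation. -/
theorem twoRowConcl_of_rowPerm (σ : Equiv.Perm (Fin 4)) {W W' : Submodule K (Fin 4 × Fin 4 → K)}
    (hmem : ∀ x, x ∈ W ↔ rowPermL σ x ∈ W') :
    WColType W' ∨ W2Type W' → WColType W ∨ W2Type W := by
  have hall : ∀ (x : Fin 4 × Fin 4 → K) (p q : Fin 4),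
      (∀ i j : Fin 4, i ≠ p → i ≠ q → x (σ i, j) = 0) ↔
      (∀ i j : Fin 4, i ≠ σ p → i ≠ σ q → x (i, j) = 0) := by
    intro x p q
    constructor
    · intro h i j hip hiq
      have := h (σ.symm i) j (fun e => hip (by rw [← e, Equiv.apply_symm_apply]))
        (fun e => hiq (by rw [← e, Equiv.apply_symm_apply]))
      simpa using this
    · intro h i j hip hiq
      exact h (σ i) j (σ.injective.ne hip) (σ.injective.ne hiq)
  rintro (⟨p, q, m, hpq, h⟩ | ⟨p, q, m, m', hpq, hmm, h⟩)
  · refine Or.inl ⟨σ p, σ q, m, σ.injective.ne hpq, fun x => ?_⟩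
    rw [hmem x, h]
    simp only [rowPermL_apply]
    exact and_congr (hall x p q) Iff.rfl
  · refine Or.inr ⟨σ p, σ q, m, m', σ.injective.ne hpq, hmm, fun x => ?_⟩
    rw [hmem x, h]
    simp only [rowPermL_apply]
    exact and_congr (hall x p q) Iff.rfl

/-- A permutation moving `2 ↦ p`, `3 ↦ q`. -/
theorem exists_perm_two_three {p q : Fin 4} (hpq : p ≠ q) :
    ∃ σ : Equiv.Perm (Fin 4), σ 2 = p ∧ σ 3 = q := by
  obtain ⟨τ, h0, h1⟩ := exists_perm_zero_one hpq
  have e2 : ((Equiv.swap (0 : Fin 4) 2).trans (Equiv.swap 1 3)) 2 = 0 := by decide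
  have e3 : ((Equiv.swap (0 : Fin 4) 2).trans (Equiv.swap 1 3)) 3 = 1 := by decide
  refine ⟨((Equiv.swap (0 : Fin 4) 2).trans (Equiv.swap 1 3)).trans τ, ?_, ?_⟩
  · rw [Equiv.trans_apply, e2, h0]
  · rw [Equiv.trans_apply, e3, h1]

/-! ### 5b-1 — the pencil determinant `Δ` (Cayley form) and `TPDegenerate ⇒ Δ = 0` (PROVED) -/

/-- The Cayley form: `Δ6 a b c d e f = det [[0,f,e,d],[f,0,c,b],[e,c,0,a],[d,b,a,0]]`
(python-verified, `compute/check5b.py`). -/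
def Δ6 (a b c d e f : K) : K :=
  (a * f) ^ 2 + (b * e) ^ 2 + (c * d) ^ 2 - 2 * (a * f) * (b * e) - 2 * (a * f) * (c * d)
    - 2 * (b * e) * (c * d)

/-- `ΔP α β`: the determinant of the `4 × 4` system `v ↦ (T3 v α β l)_l`, whose matrix has zero
diagonal and off-diagonal entries the pair permanents `pairPerm α β` of the complementary pair. -/
def ΔP (α β : Fin 4 → K) : K :=
  Δ6 (pairPerm α β 0 1) (pairPerm α β 0 2) (pairPerm α β 0 3) (pairPerm α β 1 2)
    (pairPerm α β 1 3) (pairPerm α β 2 3)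

/-- The system `T3 v α β = 0` written with pair permanents. -/
theorem T3_pairPerm (v α β : Fin 4 → K) :
    T3 v α β 0 = v 1 * pairPerm α β 2 3 + v 2 * pairPerm α β 1 3 + v 3 * pairPerm α β 1 2 ∧
    T3 v α β 1 = v 0 * pairPerm α β 2 3 + v 2 * pairPerm α β 0 3 + v 3 * pairPerm α β 0 2 ∧
    T3 v α β 2 = v 0 * pairPerm α β 1 3 + v 1 * pairPerm α β 0 3 + v 3 * pairPerm α β 0 1 ∧
    T3 v α β 3 = v 0 * pairPerm α β 1 2 + v 1 * pairPerm α β 0 2 + v 2 * pairPerm α β 0 1 := by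
  obtain ⟨h0, h1, h2, h3⟩ := T3_explicit v α β
  refine ⟨?_, ?_, ?_, ?_⟩
  · rw [h0]; unfold pairPerm; ring
  · rw [h1]; unfold pairPerm; ring
  · rw [h2]; unfold pairPerm; ring
  · rw [h3]; unfold pairPerm; ring

/-- **5b-1 (PROVED).** A nonzero kernel vector of the system forces its determinant to vanish
(`adj(P) · P = det P · I`, with the adjugate written out). -/
theorem ΔP_eq_zero_of_tpDegenerate {α β : Fin 4 → K} (h : TPDegenerate α β) : ΔP α β = 0 := by
  obtain ⟨v, hv, hT⟩ := h
  obtain ⟨e0, e1, e2, e3⟩ := T3_pairPerm v α β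
  have h0 := hT 0; have h1 := hT 1; have h2 := hT 2; have h3 := hT 3
  rw [e0] at h0; rw [e1] at h1; rw [e2] at h2; rw [e3] at h3
  set a := pairPerm α β 0 1
  set b := pairPerm α β 0 2
  set c := pairPerm α β 0 3
  set d := pairPerm α β 1 2
  set e := pairPerm α β 1 3
  set f := pairPerm α β 2 3
  have k0 : ΔP α β * v 0 = 0 := by
    show Δ6 a b c d e f * v 0 = 0
    unfold Δ6
    linear_combination (2 * a * b * c) * h0 + (-a * c * d - a * b * e + a ^ 2 * f) * h1 +
      (-b * c * d + b ^ 2 * e - a * b * f) * h2 + (c ^ 2 * d - b * c * e - a * c * f) * h3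
  have k1 : ΔP α β * v 1 = 0 := by
    show Δ6 a b c d e f * v 1 = 0
    unfold Δ6
    linear_combination (-a * c * d - a * b * e + a ^ 2 * f) * h0 + (2 * a * d * e) * h1 +
      (c * d ^ 2 - b * d * e - a * d * f) * h2 + (-c * d * e + b * e ^ 2 - a * e * f) * h3
  have k2 : ΔP α β * v 2 = 0 := by
    show Δ6 a b c d e f * v 2 = 0
    unfold Δ6
    linear_combination (-b * c * d + b ^ 2 * e - a * b * f) * h0 +
      (c * d ^ 2 - b * d * e - a * d * f) * h1 + (2 * b * d * f) * h2 +
      (-c * d * f - b * e * f + a * f ^ 2) * h3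
  have k3 : ΔP α β * v 3 = 0 := by
    show Δ6 a b c d e f * v 3 = 0
    unfold Δ6
    linear_combination (c ^ 2 * d - b * c * e - a * c * f) * h0 +
      (-c * d * e + b * e ^ 2 - a * e * f) * h1 + (-c * d * f - b * e * f + a * f ^ 2) * h2 +
      (2 * c * e * f) * h3
  by_contra hΔ
  apply hv
  funext i
  fin_cases i
  · exact (mul_eq_zero.mp k0).resolve_left hΔ
  · exact (mul_eq_zero.mp k1).resolve_left hΔ
  · exact (mul_eq_zero.mp k2).resolve_left hΔ
  · exact (mul_eq_zero.mp k3).resolve_left hΔ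

/-- `Δ` along the two-row slice: for `y ∈ W` (rows `2, 3` zero) the pencil determinant vanishes. -/
theorem ΔP_rows_eq_zero {W : Submodule K (Fin 4 × Fin 4 → K)}
    (hTP : ∀ y ∈ W, TPDegenerate (row y 0) (row y 1)) :
    ∀ y ∈ W, ΔP (row y 0) (row y 1) = 0 :=
  fun y hy => ΔP_eq_zero_of_tpDegenerate (hTP y hy)

/-! ### 5b-2 — algebra of `Δ`: symmetry, homogeneity, the `t → 0` limit, test-vector identities -/

theorem pairPerm_smul_left (t : K) (α β : Fin 4 → K) (i j : Fin 4) :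
    pairPerm (t • α) β i j = t * pairPerm α β i j := by
  simp only [pairPerm, Pi.smul_apply, smul_eq_mul]; ring

theorem pairPerm_add_smul_right (t : K) (α β b : Fin 4 → K) (i j : Fin 4) :
    pairPerm α (t • β + b) i j = t * pairPerm α β i j + pairPerm α b i j := by
  simp only [pairPerm, Pi.add_apply, Pi.smul_apply, smul_eq_mul]; ring

theorem ΔP_comm (α β : Fin 4 → K) : ΔP α β = ΔP β α := by
  unfold ΔP; rw [pairPerm_comm α β 0 1, pairPerm_comm α β 0 2, pairPerm_comm α β 0 3,
    pairPerm_comm α β 1 2, pairPerm_comm α β 1 3, pairPerm_comm α β 2 3]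

theorem ΔP_smul_left (t : K) (α β : Fin 4 → K) : ΔP (t • α) β = t ^ 4 * ΔP α β := by
  unfold ΔP Δ6; simp only [pairPerm_smul_left]; ring

/-- The `t → 0` limit: a polynomial of degree `≤ 4` vanishing at `t = 1, …, 5` vanishes at `0`
(fifth finite difference), applied to `t ↦ Δ6 (t p + q)`. -/
theorem Δ6_limit [CharZero K] (p q : Fin 6 → K)
    (h : ∀ t : K, t ≠ 0 → Δ6 (t * p 0 + q 0) (t * p 1 + q 1) (t * p 2 + q 2) (t * p 3 + q 3)
      (t * p 4 + q 4) (t * p 5 + q 5) = 0) :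
    Δ6 (q 0) (q 1) (q 2) (q 3) (q 4) (q 5) = 0 := by
  have h1 := h 1 one_ne_zero
  have h2 := h 2 two_ne_zero
  have h3 := h 3 (by norm_num)
  have h4 := h 4 (by norm_num)
  have h5 := h 5 (by norm_num)
  unfold Δ6 at h1 h2 h3 h4 h5 ⊢
  linear_combination 5 * h1 - 10 * h2 + 10 * h3 - 5 * h4 + h5

/-- `Δ(α, t β + b) = 0` for all `t ≠ 0` forces `Δ(α, b) = 0`. -/
theorem ΔP_limit [CharZero K] (α β b : Fin 4 → K)
    (h : ∀ t : K, t ≠ 0 → ΔP α (t • β + b) = 0) : ΔP α b = 0 := by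
  have := Δ6_limit
    ![pairPerm α β 0 1, pairPerm α β 0 2, pairPerm α β 0 3, pairPerm α β 1 2, pairPerm α β 1 3,
      pairPerm α β 2 3]
    ![pairPerm α b 0 1, pairPerm α b 0 2, pairPerm α b 0 3, pairPerm α b 1 2, pairPerm α b 1 3,
      pairPerm α b 2 3] (fun t ht => by
      have h' := h t ht
      unfold ΔP at h'
      simp only [pairPerm_add_smul_right] at h'
      simpa using h')
  simpa [ΔP] using this

/-- Test vectors for the coordinate-plane lemma: `a_j = 0`, `a_i = t`, the other two entries `1`. -/
theorem ΔP_test_t011 (t : K) (b : Fin 4 → K) :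
    ΔP ![t, 0, 1, 1] b = -4 * b 1 ^ 2 * t * (t * b 2 * b 3 + b 0 * (b 2 + b 3)) := by
  simp [ΔP, Δ6, pairPerm]; ring

theorem ΔP_test_0t11 (t : K) (b : Fin 4 → K) :
    ΔP ![0, t, 1, 1] b = -4 * b 0 ^ 2 * t * (t * b 2 * b 3 + b 1 * (b 2 + b 3)) := by
  simp [ΔP, Δ6, pairPerm]; ring

theorem ΔP_test_01t1 (t : K) (b : Fin 4 → K) :
    ΔP ![0, 1, t, 1] b = -4 * b 0 ^ 2 * t * (t * b 1 * b 3 + b 2 * (b 1 + b 3)) := by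
  simp [ΔP, Δ6, pairPerm]; ring

theorem ΔP_test_011t (t : K) (b : Fin 4 → K) :
    ΔP ![0, 1, 1, t] b = -4 * b 0 ^ 2 * t * (t * b 1 * b 2 + b 3 * (b 1 + b 2)) := by
  simp [ΔP, Δ6, pairPerm]; ring

/-- From the `t = 1, 2` instances of a test family: the triple product vanishes. -/
theorem triple_zero_of_tests [CharZero K] {x y z w : K}
    (E1 : -4 * x ^ 2 * 1 * (1 * y * z + w * (y + z)) = 0)
    (E2 : -4 * x ^ 2 * 2 * (2 * y * z + w * (y + z)) = 0) : x * y * z = 0 := by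
  have h8 : (-8 : K) * (x ^ 2 * y * z) = 0 := by linear_combination E2 - 2 * E1
  have h' : x ^ 2 * y * z = 0 := (mul_eq_zero.mp h8).resolve_left (by norm_num)
  have : (x * y * z) * x = 0 := by linear_combination h'
  rcases mul_eq_zero.mp this with h | h
  · exact h
  · rw [h]; ring

/-- **Coordinate-plane lemma (PROVED).** If `Δ(a, b) = 0` for every `a`, then every triple product
of coordinates of `b` vanishes, i.e. `b` has at most two nonzero coordinates. -/
theorem triples_zero_of_ΔP [CharZero K] (b : Fin 4 → K) (h : ∀ a : Fin 4 → K, ΔP a b = 0) :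
    b 1 * b 2 * b 3 = 0 ∧ b 0 * b 2 * b 3 = 0 ∧ b 0 * b 1 * b 3 = 0 ∧ b 0 * b 1 * b 2 = 0 := by
  refine ⟨?_, ?_, ?_, ?_⟩
  · have E1 := h ![1, 0, 1, 1]; have E2 := h ![2, 0, 1, 1]
    rw [ΔP_test_t011] at E1 E2
    exact triple_zero_of_tests E1 E2
  · have E1 := h ![0, 1, 1, 1]; have E2 := h ![0, 2, 1, 1]
    rw [ΔP_test_0t11] at E1 E2
    exact triple_zero_of_tests E1 E2
  · have E1 := h ![0, 1, 1, 1]; have E2 := h ![0, 1, 2, 1]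
    rw [ΔP_test_01t1] at E1 E2
    exact triple_zero_of_tests E1 E2
  · have E1 := h ![0, 1, 1, 1]; have E2 := h ![0, 1, 1, 2]
    rw [ΔP_test_011t] at E1 E2
    exact triple_zero_of_tests E1 E2

/-- Four vanishing triple products put `b` in a coordinate `2`-plane. -/
theorem exists_pair_support {b : Fin 4 → K}
    (h : b 1 * b 2 * b 3 = 0 ∧ b 0 * b 2 * b 3 = 0 ∧ b 0 * b 1 * b 3 = 0 ∧ b 0 * b 1 * b 2 = 0) :
    ∃ n n' : Fin 4, n ≠ n' ∧ ∀ k : Fin 4, k ≠ n → k ≠ n' → b k = 0 := by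
  obtain ⟨h123, h023, h013, h012⟩ := h
  have key : ∀ n n' : Fin 4, n ≠ n' → (∀ k : Fin 4, k ≠ n → k ≠ n' → b k = 0) →
      ∃ n n' : Fin 4, n ≠ n' ∧ ∀ k : Fin 4, k ≠ n → k ≠ n' → b k = 0 :=
    fun n n' hnn' hk => ⟨n, n', hnn', hk⟩
  by_cases h0 : b 0 = 0
  · by_cases h1 : b 1 = 0
    · exact key 2 3 (by decide) fun k hk2 hk3 => by
        fin_cases k <;> simp_all
    · by_cases h2 : b 2 = 0
      · exact key 1 3 (by decide) fun k hk1 hk3 => by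
          fin_cases k <;> simp_all
      · have h3 : b 3 = 0 := by
          rcases mul_eq_zero.mp h123 with h | h
          · rcases mul_eq_zero.mp h with h | h
            · exact absurd h h1
            · exact absurd h h2
          · exact h
        exact key 1 2 (by decide) fun k hk1 hk2 => by
          fin_cases k <;> simp_all
  · by_cases h1 : b 1 = 0
    · by_cases h2 : b 2 = 0
      · exact key 0 3 (by decide) fun k hk0 hk3 => by
          fin_cases k <;> simp_all
      · have h3 : b 3 = 0 := by
          rcases mul_eq_zero.mp h023 with h | h
          · rcases mul_eq_zero.mp h with h | h
            · exact absurd h h0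
            · exact absurd h h2
          · exact h
        exact key 0 2 (by decide) fun k hk0 hk2 => by
          fin_cases k <;> simp_all
    · have h2 : b 2 = 0 := by
        rcases mul_eq_zero.mp h012 with h | h
        · rcases mul_eq_zero.mp h with h | h
          · exact absurd h h0
          · exact absurd h h1
        · exact h
      have h3 : b 3 = 0 := by
        rcases mul_eq_zero.mp h013 with h | h
        · rcases mul_eq_zero.mp h with h | h
          · exact absurd h h0
          · exact absurd h h1
        · exact h
      exact key 0 1 (by decide) fun k hk0 hk1 => by
        fin_cases k <;> simp_all

/-- Fibre identities for the graph step: `α₃ = 0`, free entry `β₃ = 1` (resp. `α₂ = 0`, `β₂ = 1`). -/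
theorem ΔP_fibre3 (α β : Fin 4 → K) (hα : α 3 = 0) (hβ : β 3 = 1) :
    ΔP α β = -4 * α 0 * α 1 * α 2 * (α 0 * β 1 * β 2 + α 1 * β 0 * β 2 + α 2 * β 0 * β 1) := by
  simp [ΔP, Δ6, pairPerm, hα, hβ]; ring

theorem ΔP_fibre2 (α β : Fin 4 → K) (hα : α 2 = 0) (hβ : β 2 = 1) :
    ΔP α β = -4 * α 0 * α 1 * α 3 * (α 0 * β 1 * β 3 + α 1 * β 0 * β 3 + α 3 * β 0 * β 1) := by
  simp [ΔP, Δ6, pairPerm, hα, hβ]; ring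

/-- Pivot identities for the non-coordinate hyperplane case (pivot coordinate `3`, `c_i = n_i b_i`,
`a = b ∘ r` for test points `r ∈ ker c`), and the two final test points. -/
theorem ΔP_pivot01m (n b : Fin 4 → K) :
    ΔP ![b 0 * (n 3 * b 3), -(b 1 * (n 3 * b 3)), 0, -(b 3 * (n 0 * b 0 - n 1 * b 1))] b =
      (b 0 * b 1 * b 2 * b 3) ^ 2 * (4 * (n 3 * b 3) ^ 2 * (n 0 * b 0 - n 1 * b 1) ^ 2) := by
  simp [ΔP, Δ6, pairPerm]; ring

theorem ΔP_pivot01p (n b : Fin 4 → K) :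
    ΔP ![b 0 * (n 3 * b 3), b 1 * (n 3 * b 3), 0, -(b 3 * (n 0 * b 0 + n 1 * b 1))] b =
      (b 0 * b 1 * b 2 * b 3) ^ 2 * (4 * (n 3 * b 3) ^ 2 * (n 0 * b 0 + n 1 * b 1) *
        (2 * (n 3 * b 3) - n 0 * b 0 - n 1 * b 1)) := by
  simp [ΔP, Δ6, pairPerm]; ring

theorem ΔP_pivot02m (n b : Fin 4 → K) :
    ΔP ![b 0 * (n 3 * b 3), 0, -(b 2 * (n 3 * b 3)), -(b 3 * (n 0 * b 0 - n 2 * b 2))] b =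
      (b 0 * b 1 * b 2 * b 3) ^ 2 * (4 * (n 3 * b 3) ^ 2 * (n 0 * b 0 - n 2 * b 2) ^ 2) := by
  simp [ΔP, Δ6, pairPerm]; ring

theorem ΔP_final1110 (b : Fin 4 → K) :
    ΔP ![b 0, b 1, b 2, 0] b = (b 0 * b 1 * b 2 * b 3) ^ 2 * (-12) := by
  simp [ΔP, Δ6, pairPerm]; ring

theorem ΔP_final11mm (b : Fin 4 → K) :
    ΔP ![b 0, b 1, -b 2, -b 3] b = (b 0 * b 1 * b 2 * b 3) ^ 2 * 16 := by
  simp [ΔP, Δ6, pairPerm]; ring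

/-! ### 5b — the algebraic classification (PROVED, rev 3.0) -/

/-! **5b `twoRowClassify` (memo §5.3; the stub `stub_twoRowClassify` up to rev 2.8, PROVED in rev 3.0 below).**  A `6`-dimensional `W` supported
on rows `0, 1` such that `P(y₀, y₁)` is singular for every `y ∈ W` is `W_col`-type
(`rows{0,1} × (columns ≠ m)`) or `W₂`-type (one row free, the other in a coordinate `2`-plane).
Paper proof: `det P(α,β) = -4 f(α,β)`, `f = Σ_{i≠j} α_i² β_j² Π_{k∉{i,j}} α_k β_k
= (Σ_i α_i Π_{k≠i} β_k)(Σ_j β_j Π_{k≠j} α_k) − 4 Π_k α_k β_k`; (i) if `W → K⁴_α` is onto, its kernel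
is a `2`-plane `B` with `f(K⁴, B) = 0` (scale `(tα, tβ + b)`), which forces `b_i b_k b_{k'} = 0` on `B`,
so `B` is a coordinate plane, and then coefficient extraction kills the graph map ⇒ `W₂`; (ii) else
both projections are hyperplanes `A, B` and `W = A ⊕ B`; `f(A, B) = 0`; if `A = {α_m = 0}` then
`f|_{α_m=0} = β_m² (Π_{i≠m} α_i) Σ_{i≠m} α_i Π_{k∉{i,m}} β_k` forces `B ⊆ {β_m = 0} ∪ ⋃ span(e_m, e_i)`
⇒ `B = {β_m = 0}` ⇒ `W_col`; if neither is a coordinate hyperplane, rescaling `r = α/β` (`β ∈ B` with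
no zero coordinate) puts a hyperplane inside `{e₁(r) e₃(r) = 4 e₄(r)}`, impossible (the UFD step).
Why it might fail: only through a slip in case (ii)'s last step; exact finite-field censuses C11a/b
(evidence on stmt-5674) agree. [folklore] -/

/-! ### 5b-3 — two-row matrices, transports, the two cases, and the case split (driver PROVED) -/

/-- The matrix with rows `0, 1` given by `p = (α, β)` and rows `2, 3` zero; linear in `p`. -/
def mkL : ((Fin 4 → K) × (Fin 4 → K)) →ₗ[K] (Fin 4 × Fin 4 → K) where
  toFun p := fun ij => if ij.1 = 0 then p.1 ij.2 else if ij.1 = 1 then p.2 ij.2 else 0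
  map_add' p p' := by
    funext ij
    simp only [Prod.fst_add, Prod.snd_add, Pi.add_apply]
    split_ifs <;> simp
  map_smul' c p := by
    funext ij
    simp only [Prod.smul_fst, Prod.smul_snd, Pi.smul_apply, smul_eq_mul, RingHom.id_apply]
    split_ifs <;> simp

@[simp] theorem mkL_apply_zero (p : (Fin 4 → K) × (Fin 4 → K)) (j : Fin 4) :
    mkL p (0, j) = p.1 j := by simp [mkL]
@[simp] theorem mkL_apply_one (p : (Fin 4 → K) × (Fin 4 → K)) (j : Fin 4) :
    mkL p (1, j) = p.2 j := by simp [mkL]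
@[simp] theorem mkL_apply_two (p : (Fin 4 → K) × (Fin 4 → K)) (j : Fin 4) :
    mkL p (2, j) = 0 := by simp [mkL]
@[simp] theorem mkL_apply_three (p : (Fin 4 → K) × (Fin 4 → K)) (j : Fin 4) :
    mkL p (3, j) = 0 := by simp [mkL]
theorem row_mkL_zero (p : (Fin 4 → K) × (Fin 4 → K)) : row (mkL p) 0 = p.1 :=
  funext fun j => mkL_apply_zero p j
theorem row_mkL_one (p : (Fin 4 → K) × (Fin 4 → K)) : row (mkL p) 1 = p.2 :=
  funext fun j => mkL_apply_one p j

/-- A matrix with rows `2, 3` zero is `mkL` of its first two rows. -/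
theorem mkL_rows_eq (x : Fin 4 × Fin 4 → K) (h : ∀ j, x (2, j) = 0 ∧ x (3, j) = 0) :
    mkL (row x 0, row x 1) = x := by
  funext ij
  obtain ⟨i, j⟩ := ij
  fin_cases i
  · simp
  · simp
  · simp [(h j).1]
  · simp [(h j).2]

theorem eq_zero_of_rows (x : Fin 4 × Fin 4 → K) (h : ∀ j, x (2, j) = 0 ∧ x (3, j) = 0)
    (h0 : row x 0 = 0) (h1 : row x 1 = 0) : x = 0 := by
  rw [← mkL_rows_eq x h, h0, h1]
  exact map_zero mkL

/-- Column permutation `x ↦ ((i, j) ↦ x (i, γ j))`. -/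
def colPermL (γ : Equiv.Perm (Fin 4)) : (Fin 4 × Fin 4 → K) ≃ₗ[K] (Fin 4 × Fin 4 → K) :=
  biPermL 1 γ

@[simp] theorem colPermL_apply (γ : Equiv.Perm (Fin 4)) (x : Fin 4 × Fin 4 → K) (i j : Fin 4) :
    colPermL γ x (i, j) = x (i, γ j) := rfl

theorem row_colPermL (γ : Equiv.Perm (Fin 4)) (x : Fin 4 × Fin 4 → K) (i : Fin 4) :
    row (colPermL γ x) i = row x i ∘ γ := rfl

/-- `TPDegenerate` is invariant under a simultaneous permutation of the coordinates. -/
theorem tpDegenerate_comp_of (γ : Equiv.Perm (Fin 4)) {α β : Fin 4 → K} (h : TPDegenerate α β) :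
    TPDegenerate (α ∘ γ) (β ∘ γ) := by
  obtain ⟨v, hv, hT⟩ := h
  refine ⟨v ∘ γ, fun h0 => hv ?_, fun l => by rw [T3_perm]; exact hT (γ l)⟩
  funext i
  have := congr_fun h0 (γ.symm i)
  simpa using this

theorem tpDegenerate_comp_iff (γ : Equiv.Perm (Fin 4)) (α β : Fin 4 → K) :
    TPDegenerate (α ∘ γ) (β ∘ γ) ↔ TPDegenerate α β := by
  refine ⟨fun h => ?_, tpDegenerate_comp_of γ⟩
  have h' := tpDegenerate_comp_of γ.symm h
  have e1 : (α ∘ γ) ∘ γ.symm = α := by funext i; simp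
  have e2 : (β ∘ γ) ∘ γ.symm = β := by funext i; simp
  rwa [e1, e2] at h'

theorem tpDegenerate_symm {α β : Fin 4 → K} (h : TPDegenerate α β) : TPDegenerate β α := by
  obtain ⟨v, hv, hT⟩ := h
  exact ⟨v, hv, fun l => by rw [T3_swap₂₃]; exact hT l⟩

/-- The two-row types pull back along a column permutation. -/
theorem twoRowConcl_of_colPerm (γ : Equiv.Perm (Fin 4)) {W W' : Submodule K (Fin 4 × Fin 4 → K)}
    (hmem : ∀ x, x ∈ W ↔ colPermL γ x ∈ W') :
    WColType W' ∨ W2Type W' → WColType W ∨ W2Type W := by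
  have hall : ∀ (x : Fin 4 × Fin 4 → K) (p q : Fin 4),
      (∀ i j : Fin 4, i ≠ p → i ≠ q → x (i, γ j) = 0) ↔
      (∀ i j : Fin 4, i ≠ p → i ≠ q → x (i, j) = 0) := by
    intro x p q
    constructor
    · intro h i j hip hiq
      have := h i (γ.symm j) hip hiq
      simpa using this
    · intro h i j hip hiq
      exact h i (γ j) hip hiq
  rintro (⟨p, q, m, hpq, h⟩ | ⟨p, q, m, m', hpq, hmm, h⟩)
  · refine Or.inl ⟨p, q, γ m, hpq, fun x => ?_⟩
    rw [hmem x, h]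
    simp only [colPermL_apply]
    exact and_congr (hall x p q) Iff.rfl
  · refine Or.inr ⟨p, q, γ m, γ m', hpq, γ.injective.ne hmm, fun x => ?_⟩
    rw [hmem x, h]
    simp only [colPermL_apply]
    exact and_congr (hall x p q) Iff.rfl

/-- The coordinate hyperplane `{v : v m = 0}` of `K⁴`. -/
def colHyp (m : Fin 4) : Submodule K (Fin 4 → K) := LinearMap.ker (LinearMap.proj m)

@[simp] theorem mem_colHyp (m : Fin 4) (v : Fin 4 → K) : v ∈ colHyp (K := K) m ↔ v m = 0 := by
  simp [colHyp]

theorem finrank_colHyp_le (m : Fin 4) : finrank K (colHyp (K := K) m) ≤ 3 := by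
  have hne : colHyp (K := K) m ≠ ⊤ := by
    intro h
    have : (fun _ => (1 : K)) ∈ colHyp (K := K) m := by rw [h]; exact Submodule.mem_top
    simp at this
  have := Submodule.finrank_lt hne
  rw [Module.finrank_fin_fun] at this
  omega

/-- **Case `A = K⁴` in normal position** (the kernel plane on row `1` is `span(e₂, e₃)`):
`W` is `W₂`-type. -/
def CaseTopNorm (K : Type*) [Field K] : Prop :=
  ∀ W : Submodule K (Fin 4 × Fin 4 → K), RowsTwoThreeZero W →
    (∀ y ∈ W, TPDegenerate (row y 0) (row y 1)) →
    (∀ α : Fin 4 → K, ∃ x ∈ W, row x 0 = α) →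
    (∀ x ∈ W, row x 0 = 0 → x (1, 0) = 0 ∧ x (1, 1) = 0) →
    (∀ b : Fin 4 → K, b 0 = 0 → b 1 = 0 → mkL (0, b) ∈ W) →
    W2Type W

/-- **Case both row projections are hyperplanes**: two `3`-dimensional subspaces `A, B ≤ K⁴` with
`P(a, b)` singular for all `a ∈ A`, `b ∈ B` are the SAME coordinate hyperplane. -/
def CaseHyp (K : Type*) [Field K] : Prop :=
  ∀ A B : Submodule K (Fin 4 → K), finrank K A = 3 → finrank K B = 3 →
    (∀ a ∈ A, ∀ b ∈ B, TPDegenerate a b) → ∃ m : Fin 4, A = colHyp m ∧ B = colHyp m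

/-- Fibre step (P1): an element whose row `0` is `(α₀, α₁, α₂, 0)` with `α₀ α₁ α₂ ≠ 0` has
`β₀ = β₁ = 0` (test points `β + (0, 0, y - β₂, 1 - β₃)`, identity `ΔP_fibre3`). -/
theorem fibre_step3 [CharZero K] {W : Submodule K (Fin 4 × Fin 4 → K)}
    (hTP : ∀ y ∈ W, TPDegenerate (row y 0) (row y 1))
    (hC : ∀ b : Fin 4 → K, b 0 = 0 → b 1 = 0 → mkL (0, b) ∈ W)
    {x : Fin 4 × Fin 4 → K} (hx : x ∈ W) (h3 : x (0, 3) = 0) (h0 : x (0, 0) ≠ 0)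
    (h1 : x (0, 1) ≠ 0) (h2 : x (0, 2) ≠ 0) : x (1, 0) = 0 ∧ x (1, 1) = 0 := by
  have key : ∀ y : K, x (0, 0) * x (1, 1) * y + x (0, 1) * x (1, 0) * y +
      x (0, 2) * x (1, 0) * x (1, 1) = 0 := by
    intro y
    set b : Fin 4 → K := ![0, 0, y - x (1, 2), 1 - x (1, 3)] with hb
    have hmem : x + mkL (0, b) ∈ W := W.add_mem hx (hC b (by simp [hb]) (by simp [hb]))
    have hd := ΔP_eq_zero_of_tpDegenerate (hTP _ hmem)
    rw [ΔP_fibre3 _ _ (by simp [h3]) (by simp [hb])] at hd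
    simp only [row_apply, Pi.add_apply, mkL_apply_zero, mkL_apply_one, Pi.zero_apply, add_zero,
      hb] at hd
    simp only [Matrix.cons_val_zero, Matrix.cons_val_one, Matrix.cons_val] at hd
    have h4 : (-4 : K) * x (0, 0) * x (0, 1) * x (0, 2) ≠ 0 := by
      simp [h0, h1, h2]
    have := (mul_eq_zero.mp (by linear_combination hd :
      ((-4 : K) * x (0, 0) * x (0, 1) * x (0, 2)) *
        (x (0, 0) * x (1, 1) * y + x (0, 1) * x (1, 0) * y + x (0, 2) * x (1, 0) * x (1, 1)) = 0))
    exact this.resolve_left h4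
  have k0 := key 0
  have k1 := key 1
  have hprod : x (1, 0) * x (1, 1) = 0 := by
    have : x (0, 2) * (x (1, 0) * x (1, 1)) = 0 := by linear_combination k0
    exact (mul_eq_zero.mp this).resolve_left h2
  have hsum : x (0, 0) * x (1, 1) + x (0, 1) * x (1, 0) = 0 := by
    linear_combination k1 - k0
  rcases mul_eq_zero.mp hprod with h10 | h11
  · refine ⟨h10, ?_⟩
    have : x (0, 0) * x (1, 1) = 0 := by rw [h10, mul_zero, add_zero] at hsum; exact hsum
    exact (mul_eq_zero.mp this).resolve_left h0
  · refine ⟨?_, h11⟩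
    have : x (0, 1) * x (1, 0) = 0 := by rw [h11, mul_zero, zero_add] at hsum; exact hsum
    exact (mul_eq_zero.mp this).resolve_left h1

/-- Fibre step (P2): the same with the roles of columns `2` and `3` exchanged. -/
theorem fibre_step2 [CharZero K] {W : Submodule K (Fin 4 × Fin 4 → K)}
    (hTP : ∀ y ∈ W, TPDegenerate (row y 0) (row y 1))
    (hC : ∀ b : Fin 4 → K, b 0 = 0 → b 1 = 0 → mkL (0, b) ∈ W)
    {x : Fin 4 × Fin 4 → K} (hx : x ∈ W) (h2 : x (0, 2) = 0) (h0 : x (0, 0) ≠ 0)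
    (h1 : x (0, 1) ≠ 0) (h3 : x (0, 3) ≠ 0) : x (1, 0) = 0 ∧ x (1, 1) = 0 := by
  have key : ∀ y : K, x (0, 0) * x (1, 1) * y + x (0, 1) * x (1, 0) * y +
      x (0, 3) * x (1, 0) * x (1, 1) = 0 := by
    intro y
    set b : Fin 4 → K := ![0, 0, 1 - x (1, 2), y - x (1, 3)] with hb
    have hmem : x + mkL (0, b) ∈ W := W.add_mem hx (hC b (by simp [hb]) (by simp [hb]))
    have hd := ΔP_eq_zero_of_tpDegenerate (hTP _ hmem)
    rw [ΔP_fibre2 _ _ (by simp [h2]) (by simp [hb])] at hd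
    simp only [row_apply, Pi.add_apply, mkL_apply_zero, mkL_apply_one, Pi.zero_apply, add_zero,
      hb] at hd
    simp only [Matrix.cons_val_zero, Matrix.cons_val_one, Matrix.cons_val] at hd
    have h4 : (-4 : K) * x (0, 0) * x (0, 1) * x (0, 3) ≠ 0 := by
      simp [h0, h1, h3]
    have := (mul_eq_zero.mp (by linear_combination hd :
      ((-4 : K) * x (0, 0) * x (0, 1) * x (0, 3)) *
        (x (0, 0) * x (1, 1) * y + x (0, 1) * x (1, 0) * y + x (0, 3) * x (1, 0) * x (1, 1)) = 0))
    exact this.resolve_left h4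
  have k0 := key 0
  have k1 := key 1
  have hprod : x (1, 0) * x (1, 1) = 0 := by
    have : x (0, 3) * (x (1, 0) * x (1, 1)) = 0 := by linear_combination k0
    exact (mul_eq_zero.mp this).resolve_left h3
  have hsum : x (0, 0) * x (1, 1) + x (0, 1) * x (1, 0) = 0 := by
    linear_combination k1 - k0
  rcases mul_eq_zero.mp hprod with h10 | h11
  · refine ⟨h10, ?_⟩
    have : x (0, 0) * x (1, 1) = 0 := by rw [h10, mul_zero, add_zero] at hsum; exact hsum
    exact (mul_eq_zero.mp this).resolve_left h0
  · refine ⟨?_, h11⟩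
    have : x (0, 1) * x (1, 0) = 0 := by rw [h11, mul_zero, zero_add] at hsum; exact hsum
    exact (mul_eq_zero.mp this).resolve_left h1

/-- **`CaseTopNorm` (PROVED)**: the graph map into `K⁴ / span(e₂,e₃)` vanishes on the basis
`(1,1,1,0), (1,2,1,0), (1,1,2,0), (1,1,0,1)` (fibre steps), hence everywhere; so
`W = K⁴ ⊕ span(e₂, e₃)` on rows `0, 1`, which is `W₂`-type with `p, q, m, m' = 0, 1, 0, 1`. -/
theorem caseTopNorm [CharZero K] : CaseTopNorm K := by
  intro W hZ hTP hA hB0 hC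
  -- preimages of the basis
  obtain ⟨w1, hw1, hr1⟩ := hA ![1, 1, 1, 0]
  obtain ⟨w2, hw2, hr2⟩ := hA ![1, 2, 1, 0]
  obtain ⟨w3, hw3, hr3⟩ := hA ![1, 1, 2, 0]
  obtain ⟨w4, hw4, hr4⟩ := hA ![1, 1, 0, 1]
  have e1 : ∀ j, w1 (0, j) = (![1, 1, 1, 0] : Fin 4 → K) j := fun j => congr_fun hr1 j
  have e2 : ∀ j, w2 (0, j) = (![1, 2, 1, 0] : Fin 4 → K) j := fun j => congr_fun hr2 j
  have e3 : ∀ j, w3 (0, j) = (![1, 1, 2, 0] : Fin 4 → K) j := fun j => congr_fun hr3 j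
  have e4 : ∀ j, w4 (0, j) = (![1, 1, 0, 1] : Fin 4 → K) j := fun j => congr_fun hr4 j
  have v1 := fibre_step3 hTP hC hw1 (by simp [e1]) (by simp [e1]) (by simp [e1]) (by simp [e1])
  have v2 := fibre_step3 hTP hC hw2 (by simp [e2]) (by simp [e2]) (by simp [e2]) (by simp [e2])
  have v3 := fibre_step3 hTP hC hw3 (by simp [e3]) (by simp [e3]) (by simp [e3]) (by simp [e3])
  have v4 := fibre_step2 hTP hC hw4 (by simp [e4]) (by simp [e4]) (by simp [e4]) (by simp [e4])
  -- (P3): the graph map vanishes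
  have hP3 : ∀ x ∈ W, x (1, 0) = 0 ∧ x (1, 1) = 0 := by
    intro x hx
    set c1 : K := 3 * x (0, 0) - x (0, 1) - x (0, 2) - 2 * x (0, 3) with hc1
    set c2 : K := x (0, 1) - x (0, 0) with hc2
    set c3 : K := x (0, 2) - x (0, 0) + x (0, 3) with hc3
    set c4 : K := x (0, 3) with hc4
    set z := x - (c1 • w1 + c2 • w2 + c3 • w3 + c4 • w4) with hz
    have hzW : z ∈ W := W.sub_mem hx (W.add_mem (W.add_mem (W.add_mem (W.smul_mem c1 hw1)
      (W.smul_mem c2 hw2)) (W.smul_mem c3 hw3)) (W.smul_mem c4 hw4))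
    have hz0 : row z 0 = 0 := by
      funext j
      simp only [row_apply, hz, Pi.sub_apply, Pi.add_apply, Pi.smul_apply, smul_eq_mul, e1, e2, e3,
        e4, Pi.zero_apply]
      fin_cases j <;> simp <;> ring
    have hzv := hB0 z hzW hz0
    have ez : ∀ j, z (1, j) = x (1, j) - (c1 * w1 (1, j) + c2 * w2 (1, j) + c3 * w3 (1, j) +
        c4 * w4 (1, j)) := fun j => by
      simp only [hz, Pi.sub_apply, Pi.add_apply, Pi.smul_apply, smul_eq_mul]
    refine ⟨?_, ?_⟩
    · have := hzv.1
      rw [ez, v1.1, v2.1, v3.1, v4.1] at this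
      simpa using this
    · have := hzv.2
      rw [ez, v1.2, v2.2, v3.2, v4.2] at this
      simpa using this
  -- assemble the `W₂`-type characterisation
  refine ⟨0, 1, 0, 1, zero_ne_one, zero_ne_one, fun x => ⟨fun hx => ?_, fun h => ?_⟩⟩
  · refine ⟨fun i j hi0 hi1 => ?_, (hP3 x hx).1, (hP3 x hx).2⟩
    rcases fin4_of_perm 1 i with rfl | rfl | rfl | rfl
    · exact absurd rfl hi0
    · exact absurd rfl hi1
    · exact (hZ x hx j).1
    · exact (hZ x hx j).2
  · obtain ⟨hrows, h10, h11⟩ := h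
    obtain ⟨w, hw, hrw⟩ := hA (row x 0)
    have hwv := hP3 w hw
    set b : Fin 4 → K := row x 1 - row w 1 with hb
    have hbW : mkL (0, b) ∈ W :=
      hC b (by simp [hb, h10, hwv.1]) (by simp [hb, h11, hwv.2])
    have e : x = w + mkL (0, b) := by
      funext ij
      obtain ⟨i, j⟩ := ij
      fin_cases i
      · have := congr_fun hrw j
        simp only [row_apply] at this
        simp [this]
      · simp [hb]
      · simp [hrows 2 j (by decide) (by decide), (hZ w hw j).1]
      · simp [hrows 3 j (by decide) (by decide), (hZ w hw j).2]
    rw [e]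
    exact W.add_mem hw hbW



/-- Vectors supported on the coordinate pair `{n, n'}` (as a submodule). -/
def pairSupp (n n' : Fin 4) : Submodule K (Fin 4 → K) where
  carrier := {v | ∀ k : Fin 4, k ≠ n → k ≠ n' → v k = 0}
  add_mem' := by
    intro a b ha hb k hk hk'
    simp only [Set.mem_setOf_eq] at ha hb
    simp [ha k hk hk', hb k hk hk']
  zero_mem' := by intro k hk hk'; rfl
  smul_mem' := by
    intro c a ha k hk hk'
    simp only [Set.mem_setOf_eq] at ha
    simp [ha k hk hk']

theorem mem_pairSupp {n n' : Fin 4} {v : Fin 4 → K} :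
    v ∈ pairSupp (K := K) n n' ↔ ∀ k : Fin 4, k ≠ n → k ≠ n' → v k = 0 := Iff.rfl

theorem finrank_pairSupp_le {n n' : Fin 4} (hnn' : n ≠ n') :
    finrank K (pairSupp (K := K) n n') ≤ 2 := by
  set L : (Fin 2 → K) →ₗ[K] (Fin 4 → K) :=
    Fintype.linearCombination K ![(Pi.single n (1 : K) : Fin 4 → K), Pi.single n' (1 : K)] with hL
  have hle : pairSupp (K := K) n n' ≤ LinearMap.range L := by
    intro v hv
    have hv' := mem_pairSupp.mp hv
    refine ⟨![v n, v n'], ?_⟩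
    rw [hL, Fintype.linearCombination_apply, Fin.sum_univ_two]
    funext k
    simp only [Matrix.cons_val_zero, Matrix.cons_val_one, Pi.add_apply, Pi.smul_apply,
      Pi.single_apply, smul_eq_mul, mul_ite, mul_one, mul_zero]
    by_cases hk : k = n
    · subst hk; simp [hnn']
    · by_cases hk' : k = n'
      · subst hk'; simp [hk]
      · simp [hk, hk', hv' k hk hk']
  calc finrank K (pairSupp (K := K) n n') ≤ finrank K (LinearMap.range L) :=
        Submodule.finrank_mono hle
    _ ≤ finrank K (Fin 2 → K) := LinearMap.finrank_range_le L
    _ = 2 := Module.finrank_fin_fun K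

/-- Coordinate permutation of vectors `v ↦ v ∘ γ`. -/
def vecPermL (γ : Equiv.Perm (Fin 4)) : (Fin 4 → K) ≃ₗ[K] (Fin 4 → K) :=
  LinearEquiv.funCongrLeft K K γ

@[simp] theorem vecPermL_apply (γ : Equiv.Perm (Fin 4)) (v : Fin 4 → K) (i : Fin 4) :
    vecPermL γ v i = v (γ i) := rfl

/-- Coordinate sub-case in normal position `m = 0`: if `P(a, b)` is singular for every `a` with
`a₀ = 0` and every `b` in the `3`-space `B`, then `B` is the hyperplane `{b₀ = 0}` (test vectors
`(0,t,1,1), (0,1,t,1), (0,1,1,t)` and the union lemma). -/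
theorem hyp_coord0 [CharZero K] (B : Submodule K (Fin 4 → K)) (hB3 : finrank K B = 3)
    (h : ∀ a : Fin 4 → K, a 0 = 0 → ∀ b ∈ B, TPDegenerate a b) : B ≤ colHyp 0 := by
  have hpt : ∀ b ∈ B, b 0 = 0 ∨ ∃ i : Fin 4, i ≠ 0 ∧ b ∈ pairSupp (K := K) 0 i := by
    intro b hb
    have t023 : b 0 * b 2 * b 3 = 0 := by
      have E1 := ΔP_eq_zero_of_tpDegenerate (h ![0, 1, 1, 1] (by simp) b hb)
      have E2 := ΔP_eq_zero_of_tpDegenerate (h ![0, 2, 1, 1] (by simp) b hb)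
      rw [ΔP_test_0t11] at E1 E2
      exact triple_zero_of_tests E1 E2
    have t013 : b 0 * b 1 * b 3 = 0 := by
      have E1 := ΔP_eq_zero_of_tpDegenerate (h ![0, 1, 1, 1] (by simp) b hb)
      have E2 := ΔP_eq_zero_of_tpDegenerate (h ![0, 1, 2, 1] (by simp) b hb)
      rw [ΔP_test_01t1] at E1 E2
      exact triple_zero_of_tests E1 E2
    have t012 : b 0 * b 1 * b 2 = 0 := by
      have E1 := ΔP_eq_zero_of_tpDegenerate (h ![0, 1, 1, 1] (by simp) b hb)
      have E2 := ΔP_eq_zero_of_tpDegenerate (h ![0, 1, 1, 2] (by simp) b hb)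
      rw [ΔP_test_011t] at E1 E2
      exact triple_zero_of_tests E1 E2
    by_cases hb0 : b 0 = 0
    · exact Or.inl hb0
    · right
      have h23 : b 2 * b 3 = 0 := by
        have : b 0 * (b 2 * b 3) = 0 := by linear_combination t023
        exact (mul_eq_zero.mp this).resolve_left hb0
      have h13 : b 1 * b 3 = 0 := by
        have : b 0 * (b 1 * b 3) = 0 := by linear_combination t013
        exact (mul_eq_zero.mp this).resolve_left hb0
      have h12 : b 1 * b 2 = 0 := by
        have : b 0 * (b 1 * b 2) = 0 := by linear_combination t012
        exact (mul_eq_zero.mp this).resolve_left hb0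
      by_cases hb1 : b 1 = 0
      · by_cases hb2 : b 2 = 0
        · refine ⟨3, by decide, mem_pairSupp.mpr fun k hk0 hk3 => ?_⟩
          fin_cases k
          · exact absurd rfl hk0
          · exact hb1
          · exact hb2
          · exact absurd rfl hk3
        · have hb3 : b 3 = 0 := (mul_eq_zero.mp h23).resolve_left hb2
          refine ⟨2, by decide, mem_pairSupp.mpr fun k hk0 hk2 => ?_⟩
          fin_cases k
          · exact absurd rfl hk0
          · exact hb1
          · exact absurd rfl hk2
          · exact hb3
      · have hb2 : b 2 = 0 := (mul_eq_zero.mp h12).resolve_left hb1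
        have hb3 : b 3 = 0 := (mul_eq_zero.mp h13).resolve_left hb1
        refine ⟨1, by decide, mem_pairSupp.mpr fun k hk0 hk1 => ?_⟩
        fin_cases k
        · exact absurd rfl hk0
        · exact absurd rfl hk1
        · exact hb2
        · exact hb3
  by_contra hnot
  let piece : Fin 4 → Submodule K (Fin 4 → K) :=
    fun i => if i = 0 then colHyp 0 else pairSupp 0 i
  have hne : ∀ i, (piece i).comap B.subtype ≠ ⊤ := by
    intro i htop
    have hall : ∀ b ∈ B, b ∈ piece i := fun b hb => by
      have : (⟨b, hb⟩ : B) ∈ (piece i).comap B.subtype := by rw [htop]; exact Submodule.mem_top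
      exact this
    by_cases hi : i = 0
    · apply hnot
      intro b hb
      have := hall b hb
      simp only [piece, hi, if_true] at this
      exact this
    · have hle : B ≤ pairSupp (K := K) 0 i := fun b hb => by
        have := hall b hb
        simp only [piece, hi, if_false] at this
        exact this
      have h1 := Submodule.finrank_mono hle
      have h2 := finrank_pairSupp_le (K := K) (Ne.symm hi)
      omega
  obtain ⟨x, hx⟩ := Submodule.exists_forall_notMem_of_forall_ne_top _ hne
  rcases hpt x.1 x.2 with h0 | ⟨i, hi, hmem⟩
  · refine hx 0 ?_
    show B.subtype x ∈ piece 0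
    simp only [piece, if_true, Submodule.subtype_apply]
    exact (mem_colHyp 0 _).mpr h0
  · refine hx i ?_
    show B.subtype x ∈ piece i
    simp only [piece, hi, if_false, Submodule.subtype_apply]
    exact hmem

/-- Coordinate sub-case for a general coordinate `m` (transport by the transposition `(0 m)`). -/
theorem hyp_coord [CharZero K] (m : Fin 4) (B : Submodule K (Fin 4 → K)) (hB3 : finrank K B = 3)
    (h : ∀ a : Fin 4 → K, a m = 0 → ∀ b ∈ B, TPDegenerate a b) : B ≤ colHyp m := by
  set γ := Equiv.swap (0 : Fin 4) m with hγ
  set B' := B.map (vecPermL (K := K) γ : (Fin 4 → K) →ₗ[K] (Fin 4 → K)) with hB'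
  have hB3' : finrank K B' = 3 := by rw [hB', LinearEquiv.finrank_map_eq]; exact hB3
  have h' : ∀ a : Fin 4 → K, a 0 = 0 → ∀ b' ∈ B', TPDegenerate a b' := by
    intro a ha b' hb'
    obtain ⟨b, hb, rfl⟩ := Submodule.mem_map.mp hb'
    have e : a = (a ∘ γ) ∘ γ := by funext i; simp [hγ, Equiv.swap_apply_self]
    rw [e]
    exact tpDegenerate_comp_of γ (h (a ∘ γ) (by simp [hγ, ha]) b hb)
  have hle := hyp_coord0 B' hB3' h'
  intro b hb
  have hb' : (vecPermL (K := K) γ : (Fin 4 → K) →ₗ[K] (Fin 4 → K)) b ∈ B' :=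
    Submodule.mem_map_of_mem hb
  have := (mem_colHyp 0 _).mp (hle hb')
  rw [mem_colHyp]
  simpa [hγ] using this

/-- Non-coordinate sub-case, pivot `3` (PROVED): no `b` with all coordinates nonzero has `P(a, b)`
singular for every `a` in a hyperplane `Σ nᵢ aᵢ = 0` with `n₃ ≠ 0` (five explicit test points). -/
theorem noncoord_pivot3 [CharZero K] (n b : Fin 4 → K) (hb : ∀ i, b i ≠ 0) (hn3 : n 3 ≠ 0)
    (h : ∀ a : Fin 4 → K, ∑ i, n i * a i = 0 → TPDegenerate a b) : False := by
  have hP : (b 0 * b 1 * b 2 * b 3) ^ 2 ≠ 0 :=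
    pow_ne_zero 2 (mul_ne_zero (mul_ne_zero (mul_ne_zero (hb 0) (hb 1)) (hb 2)) (hb 3))
  have hc3 : n 3 * b 3 ≠ 0 := mul_ne_zero hn3 (hb 3)
  have h4c : (4 : K) * (n 3 * b 3) ^ 2 ≠ 0 := mul_ne_zero (by norm_num) (pow_ne_zero 2 hc3)
  have E1 := ΔP_eq_zero_of_tpDegenerate (h
    ![b 0 * (n 3 * b 3), -(b 1 * (n 3 * b 3)), 0, -(b 3 * (n 0 * b 0 - n 1 * b 1))]
    (by simp [Fin.sum_univ_four]; ring))
  rw [ΔP_pivot01m] at E1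
  have e01 : n 0 * b 0 = n 1 * b 1 := by
    have h1 := (mul_eq_zero.mp E1).resolve_left hP
    have h2 : (n 0 * b 0 - n 1 * b 1) ^ 2 = 0 := (mul_eq_zero.mp h1).resolve_left h4c
    exact sub_eq_zero.mp ((pow_eq_zero_iff (by norm_num : (2 : ℕ) ≠ 0)).mp h2)
  have E2 := ΔP_eq_zero_of_tpDegenerate (h
    ![b 0 * (n 3 * b 3), 0, -(b 2 * (n 3 * b 3)), -(b 3 * (n 0 * b 0 - n 2 * b 2))]
    (by simp [Fin.sum_univ_four]; ring))
  rw [ΔP_pivot02m] at E2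
  have e02 : n 0 * b 0 = n 2 * b 2 := by
    have h1 := (mul_eq_zero.mp E2).resolve_left hP
    have h2 : (n 0 * b 0 - n 2 * b 2) ^ 2 = 0 := (mul_eq_zero.mp h1).resolve_left h4c
    exact sub_eq_zero.mp ((pow_eq_zero_iff (by norm_num : (2 : ℕ) ≠ 0)).mp h2)
  have E3 := ΔP_eq_zero_of_tpDegenerate (h
    ![b 0 * (n 3 * b 3), b 1 * (n 3 * b 3), 0, -(b 3 * (n 0 * b 0 + n 1 * b 1))]
    (by simp [Fin.sum_univ_four]; ring))
  rw [ΔP_pivot01p] at E3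
  have e03 : n 0 * b 0 = 0 ∨ n 0 * b 0 = n 3 * b 3 := by
    have h1 := (mul_eq_zero.mp E3).resolve_left hP
    -- h1 : 4 c3² (c0 + c1) (2 c3 - c0 - c1) = 0, with c1 = c0
    have h2 : (4 : K) * (n 3 * b 3) ^ 2 * (4 * (n 0 * b 0) * (n 3 * b 3 - n 0 * b 0)) = 0 := by
      linear_combination (exp := 1) h1 - 0 * e01 +
        (4 * (n 3 * b 3) ^ 2) * (2 * (n 3 * b 3) - 3 * (n 0 * b 0) - (n 1 * b 1)) * e01
    have h3 := (mul_eq_zero.mp h2).resolve_left h4c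
    rcases mul_eq_zero.mp h3 with h5 | h5
    · left; exact (mul_eq_zero.mp h5).resolve_left (by norm_num)
    · right; exact (sub_eq_zero.mp h5).symm
  rcases e03 with hc0 | hc0
  · have E4 := ΔP_eq_zero_of_tpDegenerate (h ![b 0, b 1, b 2, 0] (by
      simp [Fin.sum_univ_four]
      linear_combination (exp := 1) 3 * hc0 - e01 - e02))
    rw [ΔP_final1110] at E4
    have := (mul_eq_zero.mp E4).resolve_left hP
    norm_num at this
  · have E5 := ΔP_eq_zero_of_tpDegenerate (h ![b 0, b 1, -b 2, -b 3] (by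
      simp [Fin.sum_univ_four]
      linear_combination (exp := 1) hc0 - e01 + e02))
    rw [ΔP_final11mm] at E5
    have := (mul_eq_zero.mp E5).resolve_left hP
    norm_num at this

/-- **`CaseHyp` (PROVED)**: coordinate sub-case by `hyp_coord` (either side), non-coordinate
sub-case by a normal functional of `A`, a vector of `B` with no zero coordinate (union lemma), a
pivot transport and `noncoord_pivot3`. -/
theorem caseHyp [CharZero K] : CaseHyp K := by
  intro A B hA3 hB3 hTP
  by_cases hcoA : ∃ m, A ≤ colHyp m
  · obtain ⟨m, hAm⟩ := hcoA
    have hAeq : A = colHyp m :=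
      Submodule.eq_of_le_of_finrank_le hAm (by rw [hA3]; exact finrank_colHyp_le m)
    have hBle : B ≤ colHyp m := hyp_coord m B hB3
      (fun a ha b hb => hTP a (by rw [hAeq, mem_colHyp]; exact ha) b hb)
    have hBeq : B = colHyp m :=
      Submodule.eq_of_le_of_finrank_le hBle (by rw [hB3]; exact finrank_colHyp_le m)
    exact ⟨m, hAeq, hBeq⟩
  by_cases hcoB : ∃ m, B ≤ colHyp m
  · obtain ⟨m, hBm⟩ := hcoB
    have hBeq : B = colHyp m :=
      Submodule.eq_of_le_of_finrank_le hBm (by rw [hB3]; exact finrank_colHyp_le m)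
    have hAle : A ≤ colHyp m := hyp_coord m A hA3
      (fun b hb a ha => tpDegenerate_symm (hTP a ha b (by rw [hBeq, mem_colHyp]; exact hb)))
    have hAeq : A = colHyp m :=
      Submodule.eq_of_le_of_finrank_le hAle (by rw [hA3]; exact finrank_colHyp_le m)
    exact ⟨m, hAeq, hBeq⟩
  exfalso
  push Not at hcoA hcoB
  -- a vector of `B` with no zero coordinate
  have hneB : ∀ i : Fin 4, (colHyp (K := K) i).comap B.subtype ≠ ⊤ := by
    intro i htop
    apply hcoB i
    intro b hb
    have : (⟨b, hb⟩ : B) ∈ (colHyp (K := K) i).comap B.subtype := by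
      rw [htop]; exact Submodule.mem_top
    exact this
  obtain ⟨bb, hbb⟩ := Submodule.exists_forall_notMem_of_forall_ne_top _ hneB
  have hb : ∀ i, bb.1 i ≠ 0 := fun i hi => hbb i (by
    show B.subtype bb ∈ colHyp (K := K) i
    exact (mem_colHyp i _).mpr hi)
  -- a normal functional of `A`
  have hAlt : A < ⊤ := by
    refine lt_top_iff_ne_top.mpr fun h => ?_
    have := hA3
    rw [h, finrank_top, Module.finrank_fin_fun] at this
    omega
  obtain ⟨φ, hφ, hAφ⟩ := Submodule.exists_le_ker_of_lt_top A hAlt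
  have hAeq : A = LinearMap.ker φ := by
    refine Submodule.eq_of_le_of_finrank_le hAφ ?_
    have hne : LinearMap.ker φ ≠ ⊤ := by
      intro h
      apply hφ
      refine LinearMap.ext fun v => ?_
      have : (v : Fin 4 → K) ∈ LinearMap.ker φ := by rw [h]; exact Submodule.mem_top
      simpa using this
    have := Submodule.finrank_lt hne
    rw [Module.finrank_fin_fun] at this
    omega
  set n : Fin 4 → K := fun i => φ (fun j => if i = j then 1 else 0) with hn
  have hφa : ∀ a : Fin 4 → K, φ a = ∑ i, n i * a i := by
    intro a
    rw [LinearMap.pi_apply_eq_sum_univ φ a]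
    refine Finset.sum_congr rfl fun i _ => ?_
    rw [smul_eq_mul, hn, mul_comm]
  have hmemA : ∀ a : Fin 4 → K, ∑ i, n i * a i = 0 → a ∈ A := fun a ha => by
    rw [hAeq, LinearMap.mem_ker, hφa]; exact ha
  have hn0 : ∃ k, n k ≠ 0 := by
    by_contra hno
    push Not at hno
    apply hφ
    refine LinearMap.ext fun a => ?_
    rw [hφa]
    simp [hno]
  obtain ⟨k, hk⟩ := hn0
  -- transport the pivot `k ↦ 3`
  set γ := Equiv.swap (3 : Fin 4) k with hγ
  refine noncoord_pivot3 (n ∘ γ) (bb.1 ∘ γ) (fun i => hb (γ i)) (by simpa [hγ] using hk) ?_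
  intro a' ha'
  have hsum : ∑ i, n i * (a' ∘ γ) i = 0 := by
    have e1 : ∑ i, n i * (a' ∘ γ) i = ∑ i, (fun i => n i * (a' ∘ γ) i) (γ i) :=
      (Equiv.sum_comp γ (fun i => n i * (a' ∘ γ) i)).symm
    rw [e1]
    simpa [hγ, Equiv.swap_apply_self, Function.comp] using ha'
  have hT := hTP (a' ∘ γ) (hmemA _ hsum) bb.1 bb.2
  have e : a' = (a' ∘ γ) ∘ γ := by funext i; simp [hγ, Equiv.swap_apply_self]
  rw [e]
  exact tpDegenerate_comp_of γ hT

/-- Rank bookkeeping for two maps out of a `6`-dimensional space whose joint kernel is trivial and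
whose ranges have dimension `≤ 3`: both ranges are `3`-dimensional and the second map is onto its
range already on the kernel of the first. -/
theorem fibre_aux {U : Type*} [AddCommGroup U] [Module K U] [FiniteDimensional K U]
    (f0 f1 : U →ₗ[K] (Fin 4 → K)) (hinj : ∀ z, f0 z = 0 → f1 z = 0 → z = 0)
    (hU : finrank K U = 6) (hA : finrank K (LinearMap.range f0) ≤ 3)
    (hB : finrank K (LinearMap.range f1) ≤ 3) :
    finrank K (LinearMap.range f0) = 3 ∧ finrank K (LinearMap.range f1) = 3 ∧
      ∀ b ∈ LinearMap.range f1, ∃ z, f0 z = 0 ∧ f1 z = b := by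
  set g : LinearMap.ker f0 →ₗ[K] LinearMap.range f1 :=
    (f1 ∘ₗ (LinearMap.ker f0).subtype).codRestrict (LinearMap.range f1)
      (fun z => LinearMap.mem_range_self f1 z.1) with hg
  have hginj : Function.Injective g := by
    refine (injective_iff_map_eq_zero g).mpr fun z hz => ?_
    have h1 : f1 z.1 = 0 := by
      have := congr_arg Subtype.val hz
      simpa [hg] using this
    have h0 : f0 z.1 = 0 := LinearMap.mem_ker.mp z.2
    exact Subtype.ext (hinj z.1 h0 h1)
  have h1 := LinearMap.finrank_range_add_finrank_ker f0
  have h2 := LinearMap.finrank_le_finrank_of_injective hginj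
  rw [hU] at h1
  have hA3 : finrank K (LinearMap.range f0) = 3 := by omega
  have hK3 : finrank K (LinearMap.ker f0) = 3 := by omega
  have hB3 : finrank K (LinearMap.range f1) = 3 := by omega
  refine ⟨hA3, hB3, fun b hb => ?_⟩
  have htop : LinearMap.range g = ⊤ := by
    apply Submodule.eq_top_of_finrank_eq
    rw [LinearMap.finrank_range_of_inj hginj, hK3, hB3]
  have : (⟨b, hb⟩ : LinearMap.range f1) ∈ LinearMap.range g := by rw [htop]; exact Submodule.mem_top
  obtain ⟨z, hz⟩ := LinearMap.mem_range.mp this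
  refine ⟨z.1, LinearMap.mem_ker.mp z.2, ?_⟩
  have := congr_arg Subtype.val hz
  simpa [hg] using this

/-- **Case `A = K⁴`** (general position), reduced to `CaseTopNorm` by the coordinate-plane lemma,
the union lemma and a column transport. -/
theorem caseTop [CharZero K] (hTop : CaseTopNorm K) (W : Submodule K (Fin 4 × Fin 4 → K))
    (h6 : finrank K W = 6) (hZ : RowsTwoThreeZero W)
    (hTP : ∀ y ∈ W, TPDegenerate (row y 0) (row y 1))
    (hA : ∀ α : Fin 4 → K, ∃ x ∈ W, row x 0 = α) : WColType W ∨ W2Type W := by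
  -- (1) Δ(α, b) = 0 for every α and every kernel vector b = row z 1 (z ∈ W, row z 0 = 0)
  have hΔ0 : ∀ z ∈ W, row z 0 = 0 → ∀ α : Fin 4 → K, ΔP α (row z 1) = 0 := by
    intro z hz hz0 α
    obtain ⟨x, hx, hxα⟩ := hA α
    apply ΔP_limit α (row x 1) (row z 1)
    intro t ht
    have hmem : t • x + z ∈ W := W.add_mem (W.smul_mem t hx) hz
    have hd := ΔP_eq_zero_of_tpDegenerate (hTP _ hmem)
    have e0 : row (t • x + z) 0 = t • α := by rw [row_add, row_smul, hxα, hz0, add_zero]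
    have e1 : row (t • x + z) 1 = t • row x 1 + row z 1 := by rw [row_add, row_smul]
    rw [e0, e1, ΔP_smul_left] at hd
    exact (mul_eq_zero.mp hd).resolve_left (pow_ne_zero 4 ht)
  -- (2) pointwise: such a `row z 1` lies in a coordinate `2`-plane
  have hpt : ∀ z ∈ W, row z 0 = 0 → ∃ n n' : Fin 4, n ≠ n' ∧ row z 1 ∈ pairSupp (K := K) n n' := by
    intro z hz hz0
    obtain ⟨n, n', hnn', hk⟩ := exists_pair_support (triples_zero_of_ΔP (row z 1) (hΔ0 z hz hz0))
    exact ⟨n, n', hnn', mem_pairSupp.mpr hk⟩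
  -- (3) the kernel of `row 0` on `W` and its (injective) image under `row 1`
  set f0 : W →ₗ[K] (Fin 4 → K) := (rowL (K := K) 0).domRestrict W with hf0
  set f1 : W →ₗ[K] (Fin 4 → K) := (rowL (K := K) 1).domRestrict W with hf1
  have hf0a : ∀ z : W, f0 z = row z.1 0 := fun z => rfl
  have hf1a : ∀ z : W, f1 z = row z.1 1 := fun z => rfl
  set ψ : LinearMap.ker f0 →ₗ[K] (Fin 4 → K) := f1 ∘ₗ (LinearMap.ker f0).subtype with hψ
  have hψa : ∀ z : LinearMap.ker f0, ψ z = row z.1.1 1 := fun z => rfl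
  have hK0 : finrank K (LinearMap.ker f0) = 2 := by
    have h1 := LinearMap.finrank_range_add_finrank_ker f0
    have hr : LinearMap.range f0 = ⊤ := by
      rw [LinearMap.range_eq_top]
      intro α
      obtain ⟨x, hx, hxα⟩ := hA α
      exact ⟨⟨x, hx⟩, hxα⟩
    rw [hr, finrank_top, Module.finrank_fin_fun] at h1
    have : finrank K W = 6 := h6
    omega
  have hψinj : Function.Injective ψ := by
    intro z z' hzz
    have h0 : row (z - z').1.1 0 = 0 := LinearMap.mem_ker.mp (z - z').2
    have h1 : row (z - z').1.1 1 = 0 := by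
      show row z.1.1 1 - row z'.1.1 1 = 0
      rw [← hψa, ← hψa, hzz, sub_self]
    have := eq_zero_of_rows (z - z').1.1 (hZ _ (z - z').1.2) h0 h1
    exact sub_eq_zero.mp (Subtype.ext (Subtype.ext this))
  have hR2 : finrank K (LinearMap.range ψ) = 2 := by
    rw [LinearMap.finrank_range_of_inj hψinj, hK0]
  -- (4) a uniform pair `{n, n'}` (union lemma on `range ψ`)
  obtain ⟨n, n', hnn', hle⟩ : ∃ n n' : Fin 4, n ≠ n' ∧
      LinearMap.range ψ ≤ pairSupp (K := K) n n' := by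
    by_contra hno
    push Not at hno
    have hne : ∀ pr : {pr : Fin 4 × Fin 4 // pr.1 ≠ pr.2},
        (pairSupp (K := K) pr.1.1 pr.1.2).comap (LinearMap.range ψ).subtype ≠ ⊤ := by
      intro pr htop
      apply hno pr.1.1 pr.1.2 pr.2
      intro b hb
      have : (⟨b, hb⟩ : LinearMap.range ψ) ∈
          (pairSupp (K := K) pr.1.1 pr.1.2).comap (LinearMap.range ψ).subtype := by
        rw [htop]; exact Submodule.mem_top
      exact this
    obtain ⟨bb, hbb⟩ := Submodule.exists_forall_notMem_of_forall_ne_top _ hne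
    obtain ⟨z, hz⟩ := LinearMap.mem_range.mp bb.2
    obtain ⟨n, n', hnn', hk⟩ := hpt z.1.1 z.1.2 (LinearMap.mem_ker.mp z.2)
    refine hbb ⟨(n, n'), hnn'⟩ ?_
    show bb.1 ∈ pairSupp (K := K) n n'
    rw [← hz, hψa]
    exact hk
  -- (5) the plane is full: every `b` supported on `{n, n'}` is a kernel vector
  have heq : LinearMap.range ψ = pairSupp (K := K) n n' :=
    Submodule.eq_of_le_of_finrank_le hle (by rw [hR2]; exact finrank_pairSupp_le hnn')
  have hC : ∀ b : Fin 4 → K, (∀ k : Fin 4, k ≠ n → k ≠ n' → b k = 0) → mkL (0, b) ∈ W := by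
    intro b hb
    have hb' : b ∈ LinearMap.range ψ := by rw [heq]; exact mem_pairSupp.mpr hb
    obtain ⟨z, hz⟩ := LinearMap.mem_range.mp hb'
    have h0 : row z.1.1 0 = 0 := LinearMap.mem_ker.mp z.2
    have h1 : row z.1.1 1 = b := by rw [← hψa]; exact hz
    have := mkL_rows_eq z.1.1 (hZ z.1.1 z.1.2)
    rw [h0, h1] at this
    rw [this]
    exact z.1.2
  have hB0 : ∀ z ∈ W, row z 0 = 0 → ∀ k : Fin 4, k ≠ n → k ≠ n' → z (1, k) = 0 := by
    intro z hz hz0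
    have hmem : row z 1 ∈ LinearMap.range ψ :=
      LinearMap.mem_range.mpr ⟨⟨⟨z, hz⟩, LinearMap.mem_ker.mpr hz0⟩, rfl⟩
    rw [heq] at hmem
    exact mem_pairSupp.mp hmem
  -- (6) column transport `2 ↦ n`, `3 ↦ n'` and the normal-position case
  obtain ⟨γ, hγ2, hγ3⟩ := exists_perm_two_three hnn'
  have hmem := mem_iff_map_equiv (colPermL γ) W
  set W' := W.map (colPermL (K := K) γ : (Fin 4 × Fin 4 → K) →ₗ[K] (Fin 4 × Fin 4 → K)) with hW'
  have hγ0n : γ 0 ≠ n := by rw [← hγ2]; exact fun h => by simpa using γ.injective h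
  have hγ0n' : γ 0 ≠ n' := by rw [← hγ3]; exact fun h => by simpa using γ.injective h
  have hγ1n : γ 1 ≠ n := by rw [← hγ2]; exact fun h => by simpa using γ.injective h
  have hγ1n' : γ 1 ≠ n' := by rw [← hγ3]; exact fun h => by simpa using γ.injective h
  have hZ' : RowsTwoThreeZero W' := by
    intro y hy j
    obtain ⟨x, hx, rfl⟩ := Submodule.mem_map.mp hy
    exact ⟨(hZ x hx (γ j)).1, (hZ x hx (γ j)).2⟩
  have hTP' : ∀ y ∈ W', TPDegenerate (row y 0) (row y 1) := by
    intro y hy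
    obtain ⟨x, hx, rfl⟩ := Submodule.mem_map.mp hy
    exact tpDegenerate_comp_of γ (hTP x hx)
  have hA' : ∀ α : Fin 4 → K, ∃ y ∈ W', row y 0 = α := by
    intro α
    obtain ⟨x, hx, hxα⟩ := hA (α ∘ γ.symm)
    refine ⟨colPermL γ x, Submodule.mem_map_of_mem hx, ?_⟩
    show row x 0 ∘ γ = α
    rw [hxα]; funext j; simp
  have hB0' : ∀ y ∈ W', row y 0 = 0 → y (1, 0) = 0 ∧ y (1, 1) = 0 := by
    intro y hy hy0
    obtain ⟨x, hx, rfl⟩ := Submodule.mem_map.mp hy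
    have hx0 : row x 0 = 0 := by
      funext j
      have := congr_fun hy0 (γ.symm j)
      simpa using this
    exact ⟨hB0 x hx hx0 (γ 0) hγ0n hγ0n', hB0 x hx hx0 (γ 1) hγ1n hγ1n'⟩
  have hC' : ∀ b : Fin 4 → K, b 0 = 0 → b 1 = 0 → mkL (0, b) ∈ W' := by
    intro b hb0 hb1
    have hin : mkL (0, b ∘ γ.symm) ∈ W := by
      apply hC
      intro k hk hk'
      rcases fin4_of_perm γ k with rfl | rfl | rfl | rfl
      · simpa using hb0
      · simpa using hb1
      · exact absurd hγ2 hk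
      · exact absurd hγ3 hk'
    have e : (colPermL (K := K) γ : (Fin 4 × Fin 4 → K) →ₗ[K] (Fin 4 × Fin 4 → K))
        (mkL (0, b ∘ γ.symm)) = mkL (0, b) := by
      funext ij
      obtain ⟨i, j⟩ := ij
      fin_cases i <;> simp
    rw [← e]
    exact Submodule.mem_map_of_mem hin
  exact twoRowConcl_of_colPerm γ hmem (Or.inr (hTop W' hZ' hTP' hA' hB0' hC'))

/-- **5b assembled (kernel-checked case split)**: `A = K⁴` / `B = K⁴` (row swap) / both
projections hyperplanes with `W = A ⊕ B`. -/
theorem twoRowClassify_of [CharZero K] (hTop : CaseTopNorm K) (hHyp : CaseHyp K) :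
    ∀ W : Submodule K (Fin 4 × Fin 4 → K), finrank K W = 6 → RowsTwoThreeZero W →
      (∀ y ∈ W, TPDegenerate (row y 0) (row y 1)) → WColType W ∨ W2Type W := by
  intro W h6 hZ hTP
  by_cases hA : ∀ α : Fin 4 → K, ∃ x ∈ W, row x 0 = α
  · exact caseTop hTop W h6 hZ hTP hA
  by_cases hB : ∀ β : Fin 4 → K, ∃ x ∈ W, row x 1 = β
  · -- swap the two live rows
    have hσ2 : Equiv.swap (0 : Fin 4) 1 2 = 2 := by decide
    have hσ3 : Equiv.swap (0 : Fin 4) 1 3 = 3 := by decide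
    have hσ0 : Equiv.swap (0 : Fin 4) 1 0 = 1 := by decide
    have hσ1 : Equiv.swap (0 : Fin 4) 1 1 = 0 := by decide
    have hmem := mem_iff_map_equiv (rowPermL (Equiv.swap (0 : Fin 4) 1)) W
    set W' := W.map (rowPermL (K := K) (Equiv.swap (0 : Fin 4) 1) :
      (Fin 4 × Fin 4 → K) →ₗ[K] (Fin 4 × Fin 4 → K)) with hW'
    have h6' : finrank K W' = 6 := by rw [hW', LinearEquiv.finrank_map_eq]; exact h6
    have hZ' : RowsTwoThreeZero W' := by
      intro y hy j
      obtain ⟨x, hx, rfl⟩ := Submodule.mem_map.mp hy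
      refine ⟨?_, ?_⟩
      · show x (Equiv.swap (0 : Fin 4) 1 2, j) = 0
        rw [hσ2]; exact (hZ x hx j).1
      · show x (Equiv.swap (0 : Fin 4) 1 3, j) = 0
        rw [hσ3]; exact (hZ x hx j).2
    have hrow : ∀ x : Fin 4 × Fin 4 → K,
        row ((rowPermL (K := K) (Equiv.swap (0 : Fin 4) 1) :
          (Fin 4 × Fin 4 → K) →ₗ[K] (Fin 4 × Fin 4 → K)) x) 0 = row x 1 ∧
        row ((rowPermL (K := K) (Equiv.swap (0 : Fin 4) 1) :
          (Fin 4 × Fin 4 → K) →ₗ[K] (Fin 4 × Fin 4 → K)) x) 1 = row x 0 := by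
      intro x
      refine ⟨funext fun j => ?_, funext fun j => ?_⟩
      · show x (Equiv.swap (0 : Fin 4) 1 0, j) = x (1, j)
        rw [hσ0]
      · show x (Equiv.swap (0 : Fin 4) 1 1, j) = x (0, j)
        rw [hσ1]
    have hTP' : ∀ y ∈ W', TPDegenerate (row y 0) (row y 1) := by
      intro y hy
      obtain ⟨x, hx, rfl⟩ := Submodule.mem_map.mp hy
      rw [(hrow x).1, (hrow x).2]
      exact tpDegenerate_symm (hTP x hx)
    have hA' : ∀ α : Fin 4 → K, ∃ y ∈ W', row y 0 = α := by
      intro α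
      obtain ⟨x, hx, hxα⟩ := hB α
      exact ⟨_, Submodule.mem_map_of_mem hx, by rw [(hrow x).1, hxα]⟩
    exact twoRowConcl_of_rowPerm _ hmem (caseTop hTop W' h6' hZ' hTP' hA')
  · -- both projections are proper: `W = A ⊕ B` with `A, B` hyperplanes
    push Not at hA hB
    obtain ⟨α0, hα0⟩ := hA
    obtain ⟨β0, hβ0⟩ := hB
    haveI : FiniteDimensional K W := inferInstance
    set f0 : W →ₗ[K] (Fin 4 → K) := (rowL (K := K) 0).domRestrict W with hf0
    set f1 : W →ₗ[K] (Fin 4 → K) := (rowL (K := K) 1).domRestrict W with hf1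
    have hf0a : ∀ z : W, f0 z = row z.1 0 := fun z => rfl
    have hf1a : ∀ z : W, f1 z = row z.1 1 := fun z => rfl
    have hinj : ∀ z : W, f0 z = 0 → f1 z = 0 → z = 0 := fun z h0 h1 =>
      Subtype.ext (eq_zero_of_rows z.1 (hZ z.1 z.2) h0 h1)
    have hinj' : ∀ z : W, f1 z = 0 → f0 z = 0 → z = 0 := fun z h1 h0 => hinj z h0 h1
    have hAne : LinearMap.range f0 ≠ ⊤ := by
      intro h
      have : α0 ∈ LinearMap.range f0 := by rw [h]; exact Submodule.mem_top
      obtain ⟨z, hz⟩ := LinearMap.mem_range.mp this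
      exact hα0 z.1 z.2 hz
    have hBne : LinearMap.range f1 ≠ ⊤ := by
      intro h
      have : β0 ∈ LinearMap.range f1 := by rw [h]; exact Submodule.mem_top
      obtain ⟨z, hz⟩ := LinearMap.mem_range.mp this
      exact hβ0 z.1 z.2 hz
    have hAle : finrank K (LinearMap.range f0) ≤ 3 := by
      have := Submodule.finrank_lt hAne
      rw [Module.finrank_fin_fun] at this
      omega
    have hBle : finrank K (LinearMap.range f1) ≤ 3 := by
      have := Submodule.finrank_lt hBne
      rw [Module.finrank_fin_fun] at this
      omega
    have hW6 : finrank K W = 6 := h6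
    obtain ⟨hA3, hB3, hfibB⟩ := fibre_aux f0 f1 hinj hW6 hAle hBle
    obtain ⟨-, -, hfibA⟩ := fibre_aux f1 f0 hinj' hW6 hBle hAle
    set A := LinearMap.range f0 with hAdef
    set B := LinearMap.range f1 with hBdef
    -- every pair `(a, b) ∈ A × B` is realised by an element of `W`
    have hpair : ∀ a ∈ A, ∀ b ∈ B, mkL (a, b) ∈ W := by
      intro a ha b hb
      obtain ⟨za, hza1, hza0⟩ := hfibA a ha
      obtain ⟨zb, hzb0, hzb1⟩ := hfibB b hb
      have hsum : (za + zb).1 ∈ W := (za + zb).2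
      have e : mkL (a, b) = (za + zb).1 := by
        rw [← mkL_rows_eq (za + zb).1 (hZ _ hsum)]
        congr 1
        ext1
        · show a = row (za.1 + zb.1) 0
          rw [row_add]
          change a = f0 za + f0 zb
          rw [hza0, hzb0, add_zero]
        · show b = row (za.1 + zb.1) 1
          rw [row_add]
          change b = f1 za + f1 zb
          rw [hza1, hzb1, zero_add]
      rw [e]; exact hsum
    have hTPAB : ∀ a ∈ A, ∀ b ∈ B, TPDegenerate a b := by
      intro a ha b hb
      have := hTP _ (hpair a ha b hb)
      rwa [row_mkL_zero, row_mkL_one] at this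
    obtain ⟨m, hAm, hBm⟩ := hHyp A B hA3 hB3 hTPAB
    refine Or.inl ⟨0, 1, m, zero_ne_one, fun x => ⟨fun hx => ?_, fun h => ?_⟩⟩
    · have ha : row x 0 ∈ A := LinearMap.mem_range.mpr ⟨⟨x, hx⟩, rfl⟩
      have hb : row x 1 ∈ B := LinearMap.mem_range.mpr ⟨⟨x, hx⟩, rfl⟩
      rw [hAm, mem_colHyp] at ha
      rw [hBm, mem_colHyp] at hb
      refine ⟨fun i j hi0 hi1 => ?_, ha, hb⟩
      rcases fin4_of_perm 1 i with rfl | rfl | rfl | rfl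
      · exact absurd rfl hi0
      · exact absurd rfl hi1
      · exact (hZ x hx j).1
      · exact (hZ x hx j).2
    · obtain ⟨hrows, h0, h1⟩ := h
      have ha : row x 0 ∈ A := by rw [hAm, mem_colHyp]; exact h0
      have hb : row x 1 ∈ B := by rw [hBm, mem_colHyp]; exact h1
      have h23 : ∀ j, x (2, j) = 0 ∧ x (3, j) = 0 := fun j =>
        ⟨hrows 2 j (by decide) (by decide), hrows 3 j (by decide) (by decide)⟩
      rw [← mkL_rows_eq x h23]
      exact hpair _ ha _ hb

/-- **5b `twoRowClassify` (PROVED, rev 3.0)** — the driver applied to the two proved cases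
`caseTopNorm` (graph case in normal position) and `caseHyp` (hyperplane case). -/
theorem twoRowClassify [CharZero K] :
    ∀ W : Submodule K (Fin 4 × Fin 4 → K), finrank K W = 6 → RowsTwoThreeZero W →
      (∀ y ∈ W, TPDegenerate (row y 0) (row y 1)) → WColType W ∨ W2Type W :=
  twoRowClassify_of caseTopNorm caseHyp



end Summit.ValiantsHypothesis.ValiantsHypothesis.Cruxes.SdcSuperquadratic.SingSixLeaf5b

end
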